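import Summits.BirchSwinnertonDyer.BirchSwinnertonDyer.Theorems.Rank2Observatory2DescZ2SplitOdd
import HarnessLib

/-!
# BirchSwinnertonDyer — rank ≥ 2 observatory: the casework of the `μ_θ` descent at a split odd prime (ℤ/2-torsion rows)

HONEST FRAMING: per-curve certified theorems and census instruments; no claim on BSD in rank ≥ 2.

Generic piece of the successor instrument KERNEL-2DESC-Z2 (spec
`code/b2b-bsdr2-cert-3/kernel-2desc-z2/README-Z2.md`, § "How the Lean casework should be organised",
steps 1–3). Setting: `R` a domain of characteristic `0` with ACC on divisibility (`𝓞 K`), an odd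
prime `ℓ` split as two degree-one primes `d₁, d₂ : SplitPrime R ℓ` (`…Z2SplitOdd`), `θ ∈ R` with
`θ² + Aθ + B = 0`, `res_i θ = t_i`, both simple (`A + 2t_i ≠ 0 mod ℓ`). For a rational point of
`y² = x³ + Ax² + Bx` in integral form — `x = n/e`, `e = d₀²`, `ℓ ∤ gcd(n, d₀)`,
`m² = n(n² + A n e + B e²)`, `α = n − eθ ≠ 0`, `n ≠ 0` — the pair of classes
`(bitsAt d₁ α, bitsAt d₂ α) ∈ ((ℤ/2)²)²` is one of three EXPLICIT shapes computed from residues only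
(`classes_point_cases`):

* (A) `ℓ ∤ n`, `ℓ ∤ d₀`: `(clsA A t₁ r s, clsA A t₂ r s)` with `r = n`, `s = d₀ (mod ℓ)`, both `≠ 0`;
* (B) `ℓ ∣ d₀`: `((0, sqb r), (0, sqb r))`, `r = n ≠ 0 (mod ℓ)`;
* (C) `ℓ ∣ n` (`n = ℓ^v n₀`): `(clsC A t₁ c₁ v r s, clsC A t₂ c₂ v r s)`, `r = n₀`, `s = d₀`, where
  `c_i = qrOf (res_i π_i')` is the per-prime correction bit of `bitsAt_intCast`.

Here `sqb` is the kernel-computable square bit on `ℤ/ℓ` (`qrOf = sqb` on non-zero residues), so that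
per row the inclusion of all three shapes in an explicit necessary set `N_ℓ` is a `decide` over
`(ℤ/ℓ)²`. The shallow/deep dichotomy per prime is `pres_point_shallow` / `pres_point_deep` of
`…Z2SplitOdd`. Sorry-free; axioms `propext`, `Classical.choice`, `Quot.sound`.
[cite: Cassels1991LecturesEllipticCurves, §15]
-/

-- single-conjunct summit: `Summit.BirchSwinnertonDyer.BirchSwinnertonDyer.…` repeats the name by design
set_option linter.dupNamespace false

noncomputable section

namespace Summit.BirchSwinnertonDyer.BirchSwinnertonDyer.Rank2Observatory.TwoDescZ2

/-! ## The computable square bit -/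

section sqb

variable {ℓ : ℕ} [Fact ℓ.Prime]

/-- Kernel-computable square bit on `ℤ/ℓ`: `0` on squares, `1` on non-squares. [folklore] -/
def sqb (c : ZMod ℓ) : ZMod 2 :=
  @ite _ (∃ r : ZMod ℓ, r * r = c) (Fintype.decidableExistsFintype) 0 1

/-- `qrOf = sqb` (the former is the `quadraticChar` form used by `bitsAt`). [folklore] -/
theorem qrOf_eq_sqb (c : ZMod ℓ) : qrOf c = sqb c := by
  by_cases h : IsSquare c
  · rw [(qrOf_eq_zero_iff c).mpr h, sqb, if_pos]
    obtain ⟨r, hr⟩ := h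
    exact ⟨r, hr.symm⟩
  · have h1 : qrOf c ≠ 0 := fun h0 => h ((qrOf_eq_zero_iff c).mp h0)
    have h2 : ¬ ∃ r : ZMod ℓ, r * r = c := fun ⟨r, hr⟩ => h ⟨r, hr.symm⟩
    rw [sqb, if_neg h2]
    revert h1
    generalize qrOf c = b
    revert b
    decide

end sqb

/-! ## The predicted classes -/

section Classes

variable {ℓ : ℕ} [Fact ℓ.Prime]

/-- Case (A) (`ℓ ∤ n·d₀`): shallow `(0, sqb (r − s²t))` unless `r ≡ s²t`, then deep of level `0`:
`(0, sqb r + sqb (A + 2t))`. [folklore] -/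
def clsA (A : ℤ) (t r s : ZMod ℓ) : ZMod 2 × ZMod 2 :=
  if r - s ^ 2 * t = 0 then (0, sqb r + sqb ((A : ZMod ℓ) + 2 * t)) else (0, sqb (r - s ^ 2 * t))

/-- Case (C) (`ℓ ∣ n`, `n = ℓ^v n₀`): at a prime with `t ≠ 0` shallow `(0, sqb (−s²t))`; at the prime
with `t = 0` deep of level `v` (`v̄ = v mod 2`): `(v̄, v̄·c + sqb r + sqb A)`. [folklore] -/
def clsC (A : ℤ) (t : ZMod ℓ) (c : ZMod 2) (vb : ZMod 2) (r s : ZMod ℓ) : ZMod 2 × ZMod 2 :=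
  if t = 0 then (vb, vb * c + sqb r + sqb (A : ZMod ℓ))
  else (0, sqb (-(s ^ 2 * t)))

end Classes

/-! ## The casework -/

section Casework

variable {R : Type*} [CommRing R] [CharZero R] [IsDomain R] [WfDvdMonoid R] {ℓ : ℕ} [Fact ℓ.Prime]
variable {d : SplitPrime R ℓ} {θ : R} {A B : ℤ} {t₀ : ZMod ℓ}

/-- One prime, case (A): `ℓ ∤ n`, `ℓ ∤ d₀`. [cite: Cassels1991LecturesEllipticCurves, §15] -/
theorem bitsAt_point_caseA (hq : θ ^ 2 + (A : R) * θ + (B : R) = 0) (ht : d.res θ = t₀)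
    (hs : (A : ZMod ℓ) + 2 * t₀ ≠ 0) {n e m d₀ : ℤ} (he : e = d₀ ^ 2)
    (hE : m ^ 2 = n * (n ^ 2 + A * n * e + B * e ^ 2)) (hn : (n : ZMod ℓ) ≠ 0)
    (hd₀ : (d₀ : ZMod ℓ) ≠ 0) (hα : (n : R) - (e : R) * θ ≠ 0) :
    bitsAt d ((n : R) - (e : R) * θ) = clsA A t₀ (n : ZMod ℓ) (d₀ : ZMod ℓ) := by
  have hecast : (e : ZMod ℓ) = (d₀ : ZMod ℓ) ^ 2 := by rw [he]; push_cast; ring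
  have he0 : (e : ZMod ℓ) ≠ 0 := by rw [hecast]; exact pow_ne_zero _ hd₀
  by_cases hdeep : (n : ZMod ℓ) - (d₀ : ZMod ℓ) ^ 2 * t₀ = 0
  · -- deep of level 0: `n = π⁰ · n`
    have hB' : (n : ZMod ℓ) - (e : ZMod ℓ) * t₀ = 0 := by rw [hecast]; exact hdeep
    have hpres : (n : R) = d.π ^ 0 * (n : R) := by rw [pow_zero, one_mul]
    have hresn : d.res (n : R) ≠ 0 := by rw [map_intCast]; exact hn
    obtain ⟨k', β', h1, h2, h3, h4⟩ := pres_point_deep hq ht hs he hE hB' he0 hα hpres hresn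
    rw [bitsAt_eq h1 h2, clsA, if_pos hdeep, h4, map_intCast, qrOf_eq_sqb, qrOf_eq_sqb]
    simp only [Nat.cast_zero] at h3
    rw [h3]
  · obtain ⟨h1, h2⟩ := pres_point_shallow ht (n := n) (e := e) (by rw [hecast]; exact hdeep)
    rw [bitsAt_eq h1 h2, res_point ht, clsA, if_neg hdeep, hecast, qrOf_eq_sqb]
    simp

/-- One prime, case (B): `ℓ ∣ d₀` (so `ℓ ∤ n`): shallow with residue `n`. [folklore] -/
theorem bitsAt_point_caseB (ht : d.res θ = t₀) {n e d₀ : ℤ} (he : e = d₀ ^ 2)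
    (hn : (n : ZMod ℓ) ≠ 0) (hd₀ : (d₀ : ZMod ℓ) = 0) :
    bitsAt d ((n : R) - (e : R) * θ) = (0, sqb (n : ZMod ℓ)) := by
  have he0 : (e : ZMod ℓ) = 0 := by rw [he]; push_cast; rw [hd₀]; ring
  obtain ⟨h1, h2⟩ := pres_point_shallow ht (n := n) (e := e) (by rw [he0, zero_mul, sub_zero]; exact hn)
  rw [bitsAt_eq h1 h2, res_point ht, he0, zero_mul, sub_zero, qrOf_eq_sqb]
  simp

/-- One prime, case (C): `ℓ ∣ n`, `n = ℓ^v n₀`, `ℓ ∤ n₀ d₀`; `c = qrOf (res π')`.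
[cite: Cassels1991LecturesEllipticCurves, §15] -/
theorem bitsAt_point_caseC (hq : θ ^ 2 + (A : R) * θ + (B : R) = 0) (ht : d.res θ = t₀)
    (hs : (A : ZMod ℓ) + 2 * t₀ ≠ 0) {c : ZMod 2} (hc : qrOf (d.res d.π') = c)
    {n n₀ e m d₀ : ℤ} {v : ℕ} (hv : n = (ℓ : ℤ) ^ v * n₀) (hv1 : 1 ≤ v) (hn₀ : ¬ (ℓ : ℤ) ∣ n₀)
    (he : e = d₀ ^ 2) (hE : m ^ 2 = n * (n ^ 2 + A * n * e + B * e ^ 2))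
    (hd₀ : (d₀ : ZMod ℓ) ≠ 0) (hα : (n : R) - (e : R) * θ ≠ 0) :
    bitsAt d ((n : R) - (e : R) * θ) = clsC A t₀ c (v : ZMod 2) (n₀ : ZMod ℓ) (d₀ : ZMod ℓ) := by
  have hecast : (e : ZMod ℓ) = (d₀ : ZMod ℓ) ^ 2 := by rw [he]; push_cast; ring
  have he0 : (e : ZMod ℓ) ≠ 0 := by rw [hecast]; exact pow_ne_zero _ hd₀
  have hnz : (n : ZMod ℓ) = 0 := by
    rw [ZMod.intCast_zmod_eq_zero_iff_dvd, hv]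
    exact dvd_mul_of_dvd_left (dvd_pow_self _ (by omega)) _
  have hn₀' : (n₀ : ZMod ℓ) ≠ 0 := fun h => hn₀ ((ZMod.intCast_zmod_eq_zero_iff_dvd n₀ ℓ).mp h)
  by_cases ht0 : t₀ = 0
  · -- deep of level v
    have hB' : (n : ZMod ℓ) - (e : ZMod ℓ) * t₀ = 0 := by rw [hnz, ht0, mul_zero, sub_zero]
    have hs' : (A : ZMod ℓ) + 2 * t₀ ≠ 0 := hs
    obtain ⟨hp1, hp2, hp3⟩ := pres_intCast (d := d) (R := R) hv hn₀
    obtain ⟨k', β', h1, h2, h3, h4⟩ := pres_point_deep hq ht hs he hE hB' he0 hα hp1 (by rw [hp2]; exact hp3)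
    rw [bitsAt_eq h1 h2, clsC, if_pos ht0, h4, h3, hp2, qrOf_mul (pow_ne_zero _ d.hπ') hn₀',
      qrOf_pow d.hπ', hc, ht0, mul_zero, add_zero, qrOf_eq_sqb, qrOf_eq_sqb]
  · -- shallow: residue `−e t₀ ≠ 0`
    have hres : (n : ZMod ℓ) - (e : ZMod ℓ) * t₀ ≠ 0 := by
      rw [hnz, zero_sub, neg_ne_zero]; exact mul_ne_zero he0 ht0
    obtain ⟨h1, h2⟩ := pres_point_shallow ht (n := n) (e := e) hres
    rw [bitsAt_eq h1 h2, res_point ht, clsC, if_neg ht0, hnz, hecast, zero_sub, qrOf_eq_sqb]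
    simp

variable {d₁ d₂ : SplitPrime R ℓ} {t₁ t₂ : ZMod ℓ}

/-- **The casework at a split odd prime.** For a rational point in integral form with `ℓ ∤ gcd(n, d₀)`
and `n ≠ 0`, the pair of classes of `n − eθ` at the two primes over `ℓ` has one of the three explicit
shapes (A), (B), (C). [cite: Cassels1991LecturesEllipticCurves, §15] -/
theorem classes_point_cases (hq : θ ^ 2 + (A : R) * θ + (B : R) = 0) (ht₁ : d₁.res θ = t₁)
    (ht₂ : d₂.res θ = t₂) (hs₁ : (A : ZMod ℓ) + 2 * t₁ ≠ 0) (hs₂ : (A : ZMod ℓ) + 2 * t₂ ≠ 0)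
    {c₁ c₂ : ZMod 2} (hc₁ : qrOf (d₁.res d₁.π') = c₁) (hc₂ : qrOf (d₂.res d₂.π') = c₂)
    {n e m d₀ : ℤ} (hn0 : n ≠ 0) (he : e = d₀ ^ 2) (hcop : ¬ ((ℓ : ℤ) ∣ n ∧ (ℓ : ℤ) ∣ d₀))
    (hE : m ^ 2 = n * (n ^ 2 + A * n * e + B * e ^ 2)) (hα : (n : R) - (e : R) * θ ≠ 0) :
    (∃ r s : ZMod ℓ, r ≠ 0 ∧ s ≠ 0 ∧
        (bitsAt d₁ ((n : R) - (e : R) * θ), bitsAt d₂ ((n : R) - (e : R) * θ)) =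
          (clsA A t₁ r s, clsA A t₂ r s)) ∨
      (∃ r : ZMod ℓ, r ≠ 0 ∧
        (bitsAt d₁ ((n : R) - (e : R) * θ), bitsAt d₂ ((n : R) - (e : R) * θ)) =
          ((0, sqb r), (0, sqb r))) ∨
      (∃ (v : ℕ) (r s : ZMod ℓ), 1 ≤ v ∧ r ≠ 0 ∧ s ≠ 0 ∧
        (bitsAt d₁ ((n : R) - (e : R) * θ), bitsAt d₂ ((n : R) - (e : R) * θ)) =
          (clsC A t₁ c₁ (v : ZMod 2) r s, clsC A t₂ c₂ (v : ZMod 2) r s)) := by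
  have hℓp : Prime (ℓ : ℤ) := Nat.prime_iff_prime_int.mp (Fact.out : ℓ.Prime)
  by_cases hn : (ℓ : ℤ) ∣ n
  · -- case (C)
    have hd₀ : ¬ (ℓ : ℤ) ∣ d₀ := fun h => hcop ⟨hn, h⟩
    have hd₀' : (d₀ : ZMod ℓ) ≠ 0 := fun h => hd₀ ((ZMod.intCast_zmod_eq_zero_iff_dvd d₀ ℓ).mp h)
    obtain ⟨v, n₀, hn₀, hv⟩ := WfDvdMonoid.max_power_factor' hn0 hℓp.not_unit
    have hv1 : 1 ≤ v := by
      by_contra h0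
      have : v = 0 := by omega
      rw [this, pow_zero, one_mul] at hv
      exact hn₀ (hv ▸ hn)
    have hn₀' : (n₀ : ZMod ℓ) ≠ 0 := fun h => hn₀ ((ZMod.intCast_zmod_eq_zero_iff_dvd n₀ ℓ).mp h)
    refine Or.inr (Or.inr ⟨v, (n₀ : ZMod ℓ), (d₀ : ZMod ℓ), hv1, hn₀', hd₀', ?_⟩)
    rw [bitsAt_point_caseC hq ht₁ hs₁ hc₁ hv hv1 hn₀ he hE hd₀' hα,
      bitsAt_point_caseC hq ht₂ hs₂ hc₂ hv hv1 hn₀ he hE hd₀' hα]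
  · have hn' : (n : ZMod ℓ) ≠ 0 := fun h => hn ((ZMod.intCast_zmod_eq_zero_iff_dvd n ℓ).mp h)
    by_cases hd₀ : (ℓ : ℤ) ∣ d₀
    · -- case (B)
      have hd₀' : (d₀ : ZMod ℓ) = 0 := (ZMod.intCast_zmod_eq_zero_iff_dvd d₀ ℓ).mpr hd₀
      refine Or.inr (Or.inl ⟨(n : ZMod ℓ), hn', ?_⟩)
      rw [bitsAt_point_caseB ht₁ he hn' hd₀', bitsAt_point_caseB ht₂ he hn' hd₀']
    · -- case (A)
      have hd₀' : (d₀ : ZMod ℓ) ≠ 0 := fun h => hd₀ ((ZMod.intCast_zmod_eq_zero_iff_dvd d₀ ℓ).mp h)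
      refine Or.inl ⟨(n : ZMod ℓ), (d₀ : ZMod ℓ), hn', hd₀', ?_⟩
      rw [bitsAt_point_caseA hq ht₁ hs₁ he hE hn' hd₀' hα, bitsAt_point_caseA hq ht₂ hs₂ he hE hn' hd₀' hα]

end Casework

end Summit.BirchSwinnertonDyer.BirchSwinnertonDyer.Rank2Observatory.TwoDescZ2

end
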